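import Mathlib
import Summits.ResolutionOfSingularities.ResolutionOfSingularities.Theorems.HomologicalConductorPersistencePointedCeilingSections
import Summits.ResolutionOfSingularities.ResolutionOfSingularities.Theorems.HomologicalConductorPersistenceHartogsCodimOne
import Literature.AlgebraicGeometry.Motives.CartierDivisorAmple
import HarnessLib

/-!
# [OURS · L1 w44b] K-PCC sheaf half, FILE 2b: sections of `𝒪_X(D)` OFF THE CLOSED FIBRE are global
# sections of `𝒪_X(D + D_W)` (pole shift), and the degree inequality (★) for them

Rung S-2 `HomologicalConductor.PersistenceSurface` (stmt-ResolutionOfSingularities-19970), route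
`ResolutionOfSingularities/HomologicalConductor`, chain W4.4b (cell res-hironaka), WAVE-3 row «stub-3 → K-PCC
SHEAF HALF» (lead memo K-PCC, res-L1-w44b-lead-1 g4; lattice half `…PersistencePointedCycles{,Definite}`).
`[OURS · L1 w44b]` folklore in the W4.4 `NoZeno` resolution vocabulary; replaces the role of no printed item;
NOT a statement of the manuscript under review and nothing of it is used; AI-written, weaker than expert review.
FILE 1a `…PersistenceCycleDivisorDegree`, FILE 1b `…PersistencePointedCeilingSections` ((★) for global
sections), FILE 2a `…PersistenceHartogsCodimOne`.

K-PCC's modules are `M_d = H⁰(X ∖ E, 𝒪_X(D))`, sections over the complement of the closed fibre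
`E = π⁻¹(𝔪)` (`CartierDivisor.IsSectionOn {x | π x ≠ 𝔪} s`); their exceptional parts `P_s = ord_E(D + div s)`
may be NEGATIVE (poles along `E`). This file reduces them to FILE 1b:

* `ordAt_cycleDivisor_eq` — the cycle divisor `D_W` has order `W η` along `E_η` (`η ∈ F`);
* **`isSection_add_cycleDivisor_of_isSectionOn`** (POLE SHIFT) — on a regular `X`, if `s` is a section of
  `𝒪_X(D)` off the closed fibre, `F` contains every point of the closed fibre of codimension `≤ 1`, and
  `W ≥ −ord_F(D + div s)`, then `s ∈ Γ(X, 𝒪_X(D + D_W))`: at points off `E` the extra factor is a unit/regular;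
  at the curves `η ∈ F` the order is `≥ 0` (FILE 2a `isRegularAt_of_ord_nonneg`); at the closed points of `E`
  by algebraic Hartogs in the codimension-`≤ 1` form (FILE 2a);
* **`sum_ordAt_mul_excCurveDegree_le_of_isSectionOn`** — (★) for sections off the closed fibre:
  `Σ_{η ∈ F} ord_η(D + div s) · ([E_η]·E_{η₀}) ≤ (𝒪_X(D)·E_{η₀})` with SIGNED orders `ord_η(D + div s) ∈ ℤ` —
  exactly the hypothesis shape `∀ i, Σ_j P_j M j i ≤ d_i`, `P : ι → ℤ`, of the lead's
  `PersistencePointedCyclesDefinite.least_sub_greatest_le_add` / `nonneg_of_isPointedAntinef`.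

References: U. Görtz, T. Wedhorn, *Algebraic Geometry I* (2nd ed. 2020), (11.9), Thm. 6.45 [`GortzWedhorn2020`];
J. Lipman, Publ. Math. IHÉS 36 (1969), §12 Remark 2 b)–c) (p. 221) [`Lipman1969`].
-/

set_option linter.dupNamespace false
set_option autoImplicit false

noncomputable section

open CategoryTheory AlgebraicGeometry TopologicalSpace IsLocalRing Opposite Order
open Literature.AlgebraicGeometry.Motives Literature.AlgebraicGeometry.Motives.RatFn
open Literature.AlgebraicGeometry.Resolution
open Summit.ResolutionOfSingularities.ResolutionOfSingularities.Theorems.NoZeno.SandwichCluster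

universe u

namespace Summit.ResolutionOfSingularities.ResolutionOfSingularities.Theorems.HomologicalConductor.PersistencePointedCeiling

variable {X : Scheme.{u}} [IsIntegral X] [IsLocallyNoetherian X]

/-! ## The order of a cycle divisor along its curves -/

/-- **`ord_{E_η}(D_W) = W η`** for the divisor of the cycle ideal `∏_{η ∈ F} 𝓘_{E_η}^{W η}` on a regular scheme and
`η ∈ F` (its stalk at `η` is `𝔪_η^{W η}`). [cite: GortzWedhorn2020, (11.13.3) (p. 383)] -/
theorem ordAt_cycleDivisor_eq (hX : Scheme.IsRegular X) (F : Finset X) (W : X → ℕ)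
    (hF : ∀ η ∈ F, coheight η = 1) {η : X} (hη : η ∈ F) :
    (CartierDivisor.ofIsEffectiveCartier (∏ η ∈ F, primeDivisorIdeal η ^ W η)
      (isEffectiveCartier_cycleIdeal hX F W hF)).ordAt η = W η := by
  set I := ∏ η ∈ F, primeDivisorIdeal η ^ W η
  set hI := isEffectiveCartier_cycleIdeal hX F W hF
  have hanti : ∀ η' ∈ F, η' ⤳ η → η' = η := fun η' hη' h => by
    by_contra hne
    exact not_specializes_of_coheight_eq_one (hF η' hη') (hF η hη) hne h
  have hyη := CartierDivisor.mem_cartierChart I hI η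
  rw [(CartierDivisor.ofIsEffectiveCartier I hI).ordAt_eq_ord (i := η) hyη,
    CartierDivisor.ofIsEffectiveCartier_f, ← toFunctionField_germ_eq_secFn hyη hyη]
  refine ord_toFunctionField_eq_of_span_eq hX (hF η hη) (germ_cartierGen_ne_zero I hI hyη) ?_
  rw [← stalkIdeal_eq_span_germ_cartierGen_of_mem I hI hyη]
  exact stalkIdeal_cycleIdeal_self F W hη hanti

/-! ## Pole shift: sections off the closed fibre are global sections of `D + D_W` -/

section PoleShift

variable {T : Type u} [CommRing T] [IsLocalRing T] (π : X ⟶ Spec (.of T))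

/-- **POLE SHIFT.** `X` integral, locally noetherian and regular, `π : X → Spec T` (`T` local), `F` a finite set
of codimension-one points containing every point of codimension `≤ 1` of the closed fibre, `D` a Cartier
divisor and `s ≠ 0` a section of `𝒪_X(D)` over the complement of the closed fibre. If `W η ≥ −ord_η(D + div s)`
for `η ∈ F` then `s` is a GLOBAL section of `𝒪_X(D + D_W)` (`D_W` the divisor of `∏_{η∈F} 𝓘_{E_η}^{W η}`).
[cite: GortzWedhorn2020, (11.9) (p. 374) and Thm. 6.45 (p. 203)] -/
theorem isSection_add_cycleDivisor_of_isSectionOn (hX : Scheme.IsRegular X) (F : Finset X) (W : X → ℕ)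
    (hF : ∀ η ∈ F, coheight η = 1)
    (hFE : ∀ ζ : X, π ζ = closedPoint T → coheight ζ ≤ 1 → ζ ∈ F)
    (D : CartierDivisor X) {s : X.functionField} (hs0 : s ≠ 0)
    (hs : D.IsSectionOn {x | π x ≠ closedPoint T} s)
    (hW : ∀ η ∈ F, -(D + CartierDivisor.principal s hs0).ordAt η ≤ (W η : ℤ)) :
    (D + CartierDivisor.ofIsEffectiveCartier (∏ η ∈ F, primeDivisorIdeal η ^ W η)
      (isEffectiveCartier_cycleIdeal hX F W hF)).IsSection s := by
  set DW := CartierDivisor.ofIsEffectiveCartier (∏ η ∈ F, primeDivisorIdeal η ^ W η)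
    (isEffectiveCartier_cycleIdeal hX F W hF)
  rintro ⟨i, j⟩ y ⟨hyi, hyj⟩
  change IsRegularAt y (D.f i * DW.f j * s)
  -- Hartogs on the open `U_i ∩ V_j`: regularity at its points of codimension `≤ 1` suffices
  refine isRegularAt_of_forall_coheight_le_one_of_mem hX (W := D.U i ⊓ DW.U j)
    (h := D.f i * DW.f j * s) (fun y' hy' hc => ?_) ⟨hyi, hyj⟩
  obtain ⟨hyi', hyj'⟩ := hy'
  by_cases hE : π y' = closedPoint T
  · -- a curve of the closed fibre: the order is `ord(D + div s) + W ≥ 0`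
    have hF' : y' ∈ F := hFE y' hE hc
    have h1 : coheight y' = 1 := hF y' hF'
    have hne : D.f i * DW.f j * s ≠ 0 := mul_ne_zero (mul_ne_zero (D.f_ne_zero i) (DW.f_ne_zero j)) hs0
    refine isRegularAt_of_ord_nonneg (hX y') h1 hne ?_
    have hord : Scheme.ord (D.f i * DW.f j * s) y' =
        (D + CartierDivisor.principal s hs0).ordAt y' + DW.ordAt y' := by
      rw [(D + CartierDivisor.principal s hs0).ordAt_eq_ord (i := (i, PUnit.unit)) ⟨hyi', trivial⟩,
        DW.ordAt_eq_ord hyj', mul_right_comm,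
        Scheme.ord_mul (mul_ne_zero (D.f_ne_zero i) hs0) (DW.f_ne_zero j)]
      rfl
    rw [hord, ordAt_cycleDivisor_eq hX F W hF hF']
    have := hW y' hF'
    omega
  · -- off the closed fibre: `f_i s` is regular (section) and the local equation of `D_W` is regular
    have h1 : IsRegularAt y' (D.f i * s) := hs i y' hyi' hE
    have h2 : IsRegularAt y' (DW.f j) := CartierDivisor.isEffective_ofIsEffectiveCartier _ _ j y' hyj'
    rw [mul_right_comm]
    exact h1.mul h2

/-! ## (★) for sections off the closed fibre -/

variable [IsProper π]

/-- **(★) for sections off the closed fibre, signed orders.** With `X`, `π`, `F` as in the pole shift, `D` a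
Cartier divisor, `s ≠ 0` a section of `𝒪_X(D)` off the closed fibre and `η₀ ∈ F` an integral exceptional curve:
`Σ_{η ∈ F} ord_η(D + div s) · ([E_η]·E_{η₀}) ≤ (𝒪_X(D)·E_{η₀})` — the input `P_s·C_i ≤ d_i` (`P_s : ι → ℤ`) of
K-PCC Thm 2.3 in the lead's pairing. Proof: pole shift by `W = (−P_s)⁺`, FILE 1b for the global section of
`D + D_W`, and `(D_W·E_{η₀}) = Σ W_η ([E_η]·E_{η₀})` (FILE 1a) cancels. [cite: Lipman1969, Section 12, Remark 2 b)–c) (p. 221)] -/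
theorem sum_ordAt_mul_excCurveDegree_le_of_isSectionOn (hX : Scheme.IsRegular X) (F : Finset X)
    (hF : ∀ η ∈ F, coheight η = 1)
    (hFE : ∀ ζ : X, π ζ = closedPoint T → coheight ζ ≤ 1 → ζ ∈ F)
    (D : CartierDivisor X) {s : X.functionField} (hs0 : s ≠ 0)
    (hs : D.IsSectionOn {x | π x ≠ closedPoint T} s) {η₀ : X} (hη₀F : η₀ ∈ F) (hη₀ : η₀ ∈ excCurvePoints π) :
    ∑ η ∈ F.attach, (D + CartierDivisor.principal s hs0).ordAt η *
        excCurveDegree π (CartierDivisor.ofIsEffectiveCartier (primeDivisorIdeal (η : X))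
          (isEffectiveCartier_primeDivisorIdeal_of_isRegular hX (hF η η.2))) η₀ ≤
      excCurveDegree π D η₀ := by
  -- pole orders
  set P : X → ℤ := fun η => (D + CartierDivisor.principal s hs0).ordAt η with hPdef
  set W : X → ℕ := fun η => (-P η).toNat with hWdef
  have hW : ∀ η ∈ F, -(D + CartierDivisor.principal s hs0).ordAt η ≤ (W η : ℤ) := fun η _ =>
    Int.self_le_toNat _
  set DW := CartierDivisor.ofIsEffectiveCartier (∏ η ∈ F, primeDivisorIdeal η ^ W η)
    (isEffectiveCartier_cycleIdeal hX F W hF) with hDW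
  -- `s` is a global section of `D + D_W`
  have hsec : (D + DW).IsSection s := isSection_add_cycleDivisor_of_isSectionOn π hX F W hF hFE D hs0 hs hW
  -- (★) for the global section (FILE 1b)
  have hstar := sum_ordAt_mul_excCurveDegree_le_of_isSection π hX F hF (D + DW) hs0 hsec hη₀F hη₀
  -- orders and degrees of `D + D_W`
  have hordW : ∀ η : {η // η ∈ F}, (D + DW + CartierDivisor.principal s hs0).ordAt η = P η + W η := by
    intro η
    rw [CartierDivisor.ordAt_add, CartierDivisor.ordAt_add, hDW, ordAt_cycleDivisor_eq hX F W hF η.2, hPdef]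
    simp only [CartierDivisor.ordAt_add]
    ring
  have hdegW : excCurveDegree π (D + DW) η₀ = excCurveDegree π D η₀ +
      ∑ η ∈ F.attach, (W η : ℤ) * excCurveDegree π (CartierDivisor.ofIsEffectiveCartier
        (primeDivisorIdeal (η : X)) (isEffectiveCartier_primeDivisorIdeal_of_isRegular hX (hF η η.2))) η₀ := by
    rw [excCurveDegree_add π hη₀, hDW, excCurveDegree_cycleDivisor π hX F W hF hη₀]
  rw [hdegW] at hstar
  simp only [hordW, add_mul, Finset.sum_add_distrib] at hstar
  linarith

end PoleShift

end Summit.ResolutionOfSingularities.ResolutionOfSingularities.Theorems.HomologicalConductor.PersistencePointedCeiling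

end
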